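import Summits.AtomisticToContinuum.Crystallization.Theorems.FrustratedLawDichotomyStrainedPatchHomEntryShort

/-!
# The DIRECTION prune `vecOut` (operator-norm excess along 13 integer directions), the verdict `entryLeafOK8Q`, certificate v10

decomp-a2c hand-1 g25 (crux `AperiodicFrustratedLawGap`, stmt-AtomisticToContinuum-27623), sequel of `…HomEntryShort`.

MEASURED (g25 leaf classification of the 18 finished gate32 guard addresses under `entryLeafOK7Q muRec`, 4 670 leaves): 1 847 leaves = 40 % have their
CENTRE outside the admissible ball `‖U − 1‖ ≤ 1/4` detectably along one of the 13 directions `{−1,0,1}³ ∖ 0 / ±`, yet only 56 leaves were certified by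
the column prune (the three axis directions): the rest of the inadmissible region inside the entry cube is certified ENERGETICALLY by the tables at width
`2⁻⁸…2⁻¹⁰`, and the two heavy guard addresses stop (budget) in exactly such a region (`U − 1 ≈ diag(−.11,−.2,−.2) + .10·(e₁e₂ᵀ+e₂e₁ᵀ)`: direction
`(0,1,−1)` has `|(U−1)v|² = 0.18 > |v|²/16`).  The column prune generalises verbatim from `e_b` to any integer vector `v`:
`‖(U − 1) v‖ ≤ ‖U − 1‖·‖v‖ ≤ ‖v‖/4`, and `((U − 1) v)_a = Σ_b v_b (u_ab − δ_ab)` is a linear form in the entries, so its absolute value on the box is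
`≥ max 0 (|Σ_b v_b (c_ab − δ_ab SC)| − Σ_b |v_b| w_ab) / SC =: linLo_a / SC`; the prune fires when `16 Σ_a linLo_a² > |v|² SC²`.

* §1 `dlt`, `linC`, `linR`, `linLo`, `vecOutDir`, `dirs13`, `vecOut` (computable, integers only);
* §2 ★ `false_of_vecOutDir` / `false_of_vecOut` (no `U` with `‖U − 1‖ ≤ 1/4` has its entries in such a box);
* §3 ★ `entryLeafOK8Q μ c w := vecOut (c ∘ symIdx) (w ∘ symIdx) || entryLeafOK7Q μ c w` (cheap prune FIRST), `entryLeafOK8Q_sound`, monotonicity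
  `entryLeafOK8Q_of_7Q / treeOK_8Q_of_7Q / exists_tree_8Q_of_7Q`, ★★ `fccHalf_of_entryTree8Q`, ★★★ CERTIFICATE v10 `homFloor_625_of_entryTrees8Q_HVK`;
* §4 kernel regression: `vecOut` fires on the budget-stop box of the heavy guard address `000101100010`.

Computable; 0 sorry; standard axioms; no instances / notation / `#eval`.  `--supports stmt-AtomisticToContinuum-27623`.
-/

namespace Summit.AtomisticToContinuum.Crystallization.Theorems.FrustratedLawDichotomyStrainedPatchHomEntryVec

open scoped BigOperators RealInnerProductSpace
open Literature.Analysis.ValidatedNumerics.Numerics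
open Summit.AtomisticToContinuum.Crystallization.Theorems.ChargedEnergyGapNegative (E3)
open Summit.AtomisticToContinuum.Crystallization.Theorems.FrustratedLawDichotomySchurCut (effPot w₄₅ ω₄)
open Summit.AtomisticToContinuum.Crystallization.Theorems.FrustratedLawDichotomyAveragingRuleTightFree (TightNearCap BadNearCap)
open Summit.AtomisticToContinuum.Crystallization.Theorems.FrustratedLawDichotomyExemptAbsorption (ExemptNear)
open Summit.AtomisticToContinuum.Crystallization.Theorems.FrustratedLawDichotomyStrainedPatchHomSplit
open Summit.AtomisticToContinuum.Crystallization.Theorems.FrustratedLawDichotomyStrainedPatchHomPrunedPolar (homFloor_of_prunedBoxSums_selfAdjoint)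
open Summit.AtomisticToContinuum.Crystallization.Theorems.FrustratedLawDichotomyStrainedPatchHomCoords (apply_eq_sum_entries)
open Summit.AtomisticToContinuum.Crystallization.Theorems.FrustratedLawDichotomyStrainedPatchHomCertTree (CertTree treeOK)
open Summit.AtomisticToContinuum.Crystallization.Theorems.FrustratedLawDichotomyStrainedPatchHomEntryGram (rootC rootW)
open Summit.AtomisticToContinuum.Crystallization.Theorems.FrustratedLawDichotomyStrainedPatchHomEntryGramHcp (rootCH rootWH)
open Summit.AtomisticToContinuum.Crystallization.Theorems.FrustratedLawDichotomyStrainedPatchHomEntrySix (symIdx hbox_sym)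
open Summit.AtomisticToContinuum.Crystallization.Theorems.FrustratedLawDichotomyStrainedPatchHomEntryTable (muRec muRec_ok)
open Summit.AtomisticToContinuum.Crystallization.Theorems.FrustratedLawDichotomyStrainedPatchHomEntrySign (fccHalf_of_entryTreeDom)
open Summit.AtomisticToContinuum.Crystallization.Theorems.FrustratedLawDichotomyStrainedPatchHomEntryQuick (treeOK_of_imp)
open Summit.AtomisticToContinuum.Crystallization.Theorems.FrustratedLawDichotomyStrainedPatchHomEntryShort (entryLeafOK7Q entryLeafOK7Q_sound)
open Summit.AtomisticToContinuum.Crystallization.Theorems.FrustratedLawDichotomyStrainedPatchHomLeafTableCheckHcpV (entryLeafOKHVK)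
open Summit.AtomisticToContinuum.Crystallization.Theorems.FrustratedLawDichotomyStrainedPatchHomEntryTreeCert (hcpHalf_of_entryTreeHVK)
open Literature.Barriers.AtomisticToContinuum.FlatleyTheil2015 (fccVec)

/-! ## §1. The direction prune -/

/-- Kronecker delta as an integer. -/
def dlt (a b : Fin 3) : ℤ := if a = b then 1 else 0

/-- `SC`·(centre value of the linear form `((U − 1) v)_a` on the box): `Σ_b v_b (c_ab − δ_ab·SC)`. -/
def linC (c : Fin 3 × Fin 3 → ℤ) (v : Fin 3 → ℤ) (a : Fin 3) : ℤ :=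
  v 0 * (c (a, 0) - dlt a 0 * SC) + v 1 * (c (a, 1) - dlt a 1 * SC) + v 2 * (c (a, 2) - dlt a 2 * SC)

/-- `SC`·(radius of the linear form over the box): `Σ_b |v_b| w_ab`. -/
def linR (w : Fin 3 × Fin 3 → ℤ) (v : Fin 3 → ℤ) (a : Fin 3) : ℤ := |v 0| * w (a, 0) + |v 1| * w (a, 1) + |v 2| * w (a, 2)

/-- `SC`·(lower bound of `|((U − 1) v)_a|` on the box), floored at `0`. -/
def linLo (c w : Fin 3 × Fin 3 → ℤ) (v : Fin 3 → ℤ) (a : Fin 3) : ℤ := max 0 (|linC c v a| - linR w v a)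

/-- Direction test: `‖(U − 1) v‖² > ‖v‖²/16` on the whole box (scaled). -/
def vecOutDir (c w : Fin 3 × Fin 3 → ℤ) (v : Fin 3 → ℤ) : Bool :=
  decide ((v 0 * v 0 + v 1 * v 1 + v 2 * v 2) * ((SC : ℤ) * SC) < 16 * (linLo c w v 0 ^ 2 + linLo c w v 1 ^ 2 + linLo c w v 2 ^ 2))

/-- The 13 test directions `{−1,0,1}³ ∖ 0` up to sign (axes, face diagonals, body diagonals). -/
def dirs13 : List (Fin 3 → ℤ) :=
  [![1, 0, 0], ![0, 1, 0], ![0, 0, 1], ![1, 1, 0], ![1, -1, 0], ![1, 0, 1], ![1, 0, -1], ![0, 1, 1], ![0, 1, -1],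
   ![1, 1, 1], ![1, 1, -1], ![1, -1, 1], ![1, -1, -1]]

/-- ★ **DIRECTION PRUNE**: along some of the 13 directions `(U − 1) v` is longer than `‖v‖/4` on the whole box (then `‖U − 1‖ > 1/4`: vacuous leaf). -/
def vecOut (c w : Fin 3 × Fin 3 → ℤ) : Bool := dirs13.any (vecOutDir c w)

/-! ## §2. Soundness -/

/-- `v_a = Σ_b v_b δ_ab`. [formal bookkeeping] -/
theorem self_eq_sum_dlt (v : Fin 3 → ℤ) (a : Fin 3) : v a = v 0 * dlt a 0 + v 1 * dlt a 1 + v 2 * dlt a 2 := by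
  fin_cases a <;> simp [dlt]

/-- From a deviation bound to a squared lower bound: `|x − m| ≤ r ⟹ (max 0 (|m| − r))² ≤ x²`. [folklore] -/
theorem sq_ge_of_abs_sub_le {x m r : ℝ} (h : |x - m| ≤ r) : (max 0 (|m| - r)) ^ 2 ≤ x ^ 2 := by
  have h1 : max 0 (|m| - r) ≤ |x| := by
    refine max_le (abs_nonneg _) ?_
    have : |m| ≤ |x| + |x - m| := by
      calc |m| = |x - (x - m)| := by ring_nf
        _ ≤ |x| + |x - m| := abs_sub _ _
    linarith
  have h0 : 0 ≤ max 0 (|m| - r) := le_max_left _ _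
  calc (max 0 (|m| - r)) ^ 2 ≤ |x| ^ 2 := pow_le_pow_left₀ h0 h1 2
    _ = x ^ 2 := sq_abs _

/-- ★ Soundness of one direction test: no `U` with `‖U − 1‖ ≤ 1/4` has its entries in such a box. [folklore] -/
theorem false_of_vecOutDir {c w : Fin 3 × Fin 3 → ℤ} {v : Fin 3 → ℤ} (h : vecOutDir c w v = true) (U : E3 →L[ℝ] E3) (hU : ‖U - 1‖ ≤ 1 / 4)
    (hbox : ∀ ab : Fin 3 × Fin 3, |(U (EuclideanSpace.single ab.2 (1 : ℝ))) ab.1 - (c ab : ℝ) / SC| ≤ (w ab : ℝ) / SC) : False := by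
  have hS : (0 : ℝ) < SC := SC_pos
  have hne : (SC : ℝ) ≠ 0 := SC_ne
  -- the real test vector and its coordinates
  set V : E3 := EuclideanSpace.single 0 ((v 0 : ℤ) : ℝ) + EuclideanSpace.single 1 ((v 1 : ℤ) : ℝ) + EuclideanSpace.single 2 ((v 2 : ℤ) : ℝ) with hV
  have hVa : ∀ a : Fin 3, V a = ((v a : ℤ) : ℝ) := by
    intro a; fin_cases a <;> simp [hV]
  -- entries
  set u : Fin 3 → Fin 3 → ℝ := fun a b => (U (EuclideanSpace.single b (1 : ℝ))) a with hu
  have hcoord : ∀ a : Fin 3, ((U - 1) V) a = u a 0 * (v 0 : ℝ) + u a 1 * (v 1 : ℝ) + u a 2 * (v 2 : ℝ) - (v a : ℝ) := by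
    intro a
    have e1 : ((U - 1) V) a = (U V) a - V a := by simp
    rw [e1, apply_eq_sum_entries, Fin.sum_univ_three, hVa 0, hVa 1, hVa 2, hVa a]
  -- deviation of each coordinate from its box centre
  have hdev : ∀ a : Fin 3, |((U - 1) V) a - (linC c v a : ℝ) / SC| ≤ (linR w v a : ℝ) / SC := by
    intro a
    have e : ((U - 1) V) a - (linC c v a : ℝ) / SC =
        (v 0 : ℝ) * (u a 0 - (c (a, 0) : ℝ) / SC) + (v 1 : ℝ) * (u a 1 - (c (a, 1) : ℝ) / SC) + (v 2 : ℝ) * (u a 2 - (c (a, 2) : ℝ) / SC) := by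
      rw [hcoord a, show ((v a : ℤ) : ℝ) = (v 0 : ℝ) * (dlt a 0 : ℝ) + (v 1 : ℝ) * (dlt a 1 : ℝ) + (v 2 : ℝ) * (dlt a 2 : ℝ) by
        exact_mod_cast self_eq_sum_dlt v a]
      simp only [linC]
      push_cast
      field_simp
      ring
    rw [e]
    have h0 := hbox (a, 0)
    have h1 := hbox (a, 1)
    have h2 := hbox (a, 2)
    simp only at h0 h1 h2
    have t0 : |(v 0 : ℝ) * (u a 0 - (c (a, 0) : ℝ) / SC)| ≤ (|v 0| : ℤ) * ((w (a, 0) : ℝ) / SC) := by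
      rw [abs_mul]; push_cast; exact mul_le_mul_of_nonneg_left h0 (abs_nonneg _)
    have t1 : |(v 1 : ℝ) * (u a 1 - (c (a, 1) : ℝ) / SC)| ≤ (|v 1| : ℤ) * ((w (a, 1) : ℝ) / SC) := by
      rw [abs_mul]; push_cast; exact mul_le_mul_of_nonneg_left h1 (abs_nonneg _)
    have t2 : |(v 2 : ℝ) * (u a 2 - (c (a, 2) : ℝ) / SC)| ≤ (|v 2| : ℤ) * ((w (a, 2) : ℝ) / SC) := by
      rw [abs_mul]; push_cast; exact mul_le_mul_of_nonneg_left h2 (abs_nonneg _)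
    have tri : |(v 0 : ℝ) * (u a 0 - (c (a, 0) : ℝ) / SC) + (v 1 : ℝ) * (u a 1 - (c (a, 1) : ℝ) / SC) + (v 2 : ℝ) * (u a 2 - (c (a, 2) : ℝ) / SC)|
        ≤ |(v 0 : ℝ) * (u a 0 - (c (a, 0) : ℝ) / SC)| + |(v 1 : ℝ) * (u a 1 - (c (a, 1) : ℝ) / SC)| + |(v 2 : ℝ) * (u a 2 - (c (a, 2) : ℝ) / SC)| :=
      abs_add_three _ _ _
    have eR : (linR w v a : ℝ) / SC = (|v 0| : ℤ) * ((w (a, 0) : ℝ) / SC) + (|v 1| : ℤ) * ((w (a, 1) : ℝ) / SC) + (|v 2| : ℤ) * ((w (a, 2) : ℝ) / SC) := by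
      simp only [linR]; push_cast; field_simp
    rw [eR]
    linarith
  -- squared lower bound per coordinate
  have hlo : ∀ a : Fin 3, ((linLo c w v a : ℝ) / SC) ^ 2 ≤ (((U - 1) V) a) ^ 2 := by
    intro a
    have key := sq_ge_of_abs_sub_le (hdev a)
    have e : (linLo c w v a : ℝ) / SC = max 0 (|(linC c v a : ℝ) / SC| - (linR w v a : ℝ) / SC) := by
      rw [abs_div, abs_of_pos hS, ← sub_div]
      simp only [linLo, Int.cast_max, Int.cast_zero, Int.cast_sub, Int.cast_abs]
      rcases le_total 0 (|(linC c v a : ℝ)| - (linR w v a : ℝ)) with hp | hn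
      · rw [max_eq_right hp, max_eq_right (div_nonneg hp hS.le)]
      · have hn' : (|(linC c v a : ℝ)| - (linR w v a : ℝ)) / SC ≤ 0 := by rw [div_le_iff₀ hS, zero_mul]; exact hn
        rw [max_eq_left hn, max_eq_left hn', zero_div]
    rw [e]; exact key
  -- the operator-norm bound, squared
  have h1 : ‖(U - 1) V‖ ≤ 1 / 4 * ‖V‖ := ((U - 1).le_opNorm V).trans (mul_le_mul_of_nonneg_right hU (norm_nonneg _))
  have hsq : ‖(U - 1) V‖ ^ 2 ≤ (1 / 4 * ‖V‖) ^ 2 := pow_le_pow_left₀ (norm_nonneg _) h1 2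
  have hV2 : ‖V‖ ^ 2 = (v 0 : ℝ) ^ 2 + (v 1 : ℝ) ^ 2 + (v 2 : ℝ) ^ 2 := by
    rw [EuclideanSpace.norm_sq_eq, Fin.sum_univ_three]
    simp only [Real.norm_eq_abs, sq_abs, hVa]
  have hW2 : ‖(U - 1) V‖ ^ 2 = (((U - 1) V) 0) ^ 2 + (((U - 1) V) 1) ^ 2 + (((U - 1) V) 2) ^ 2 := by
    rw [EuclideanSpace.norm_sq_eq, Fin.sum_univ_three]
    simp only [Real.norm_eq_abs, sq_abs]
  -- the integer test, cast
  have hlt : (v 0 * v 0 + v 1 * v 1 + v 2 * v 2) * ((SC : ℤ) * SC) < 16 * (linLo c w v 0 ^ 2 + linLo c w v 1 ^ 2 + linLo c w v 2 ^ 2) := by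
    simpa [vecOutDir] using h
  have hlt' : ((v 0 : ℝ) * v 0 + (v 1 : ℝ) * v 1 + (v 2 : ℝ) * v 2) * ((SC : ℝ) * SC) <
      16 * ((linLo c w v 0 : ℝ) ^ 2 + (linLo c w v 1 : ℝ) ^ 2 + (linLo c w v 2 : ℝ) ^ 2) := by exact_mod_cast hlt
  have hsum : ((linLo c w v 0 : ℝ) / SC) ^ 2 + ((linLo c w v 1 : ℝ) / SC) ^ 2 + ((linLo c w v 2 : ℝ) / SC) ^ 2 ≤ (1 / 4 * ‖V‖) ^ 2 := by
      linarith [hlo 0, hlo 1, hlo 2, hsq, hW2]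
  rw [mul_pow, hV2] at hsum
  have e3 : ((linLo c w v 0 : ℝ) / SC) ^ 2 + ((linLo c w v 1 : ℝ) / SC) ^ 2 + ((linLo c w v 2 : ℝ) / SC) ^ 2 =
      ((linLo c w v 0 : ℝ) ^ 2 + (linLo c w v 1 : ℝ) ^ 2 + (linLo c w v 2 : ℝ) ^ 2) / ((SC : ℝ) * SC) := by
    field_simp
  rw [e3, div_le_iff₀ (mul_pos hS hS)] at hsum
  nlinarith

/-- ★ Soundness of the direction prune. [folklore] -/
theorem false_of_vecOut {c w : Fin 3 × Fin 3 → ℤ} (h : vecOut c w = true) (U : E3 →L[ℝ] E3) (hU : ‖U - 1‖ ≤ 1 / 4)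
    (hbox : ∀ ab : Fin 3 × Fin 3, |(U (EuclideanSpace.single ab.2 (1 : ℝ))) ab.1 - (c ab : ℝ) / SC| ≤ (w ab : ℝ) / SC) : False := by
  simp only [vecOut, List.any_eq_true] at h
  obtain ⟨v, -, hv⟩ := h
  exact false_of_vecOutDir hv U hU hbox

/-! ## §3. The verdict `entryLeafOK8Q` and certificate v10 -/

/-- ★ **fcc VERDICT v10**: the direction prune (cheap, integers) FIRST, else the repaired verdict `entryLeafOK7Q μ`. -/
def entryLeafOK8Q (μ : ℤ) (c w : Fin 3 × Fin 3 → ℤ) : Bool := vecOut (c ∘ symIdx) (w ∘ symIdx) || entryLeafOK7Q μ c w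

/-- ★ Soundness of `entryLeafOK8Q` (domain-relativised `hver` shape of `…HomEntrySign.fccHalf_of_entryTreeDom`). [folklore] -/
theorem entryLeafOK8Q_sound {μ : ℤ} {c w : Fin 3 × Fin 3 → ℤ} (h : entryLeafOK8Q μ c w = true) (U : E3 →L[ℝ] E3)
    (hsa : ∀ v v' : E3, ⟪U v, v'⟫ = ⟪v, U v'⟫) (hU : ‖U - 1‖ ≤ 1 / 4)
    (hbox : ∀ ab : Fin 3 × Fin 3, |(U (EuclideanSpace.single ab.2 (1 : ℝ))) ab.1 - (c ab : ℝ) / SC| ≤ (w ab : ℝ) / SC)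
    (h1 : (U (EuclideanSpace.single 1 (1 : ℝ))) 1 ≤ (U (EuclideanSpace.single 0 (1 : ℝ))) 0)
    (h2 : (U (EuclideanSpace.single 2 (1 : ℝ))) 2 ≤ (U (EuclideanSpace.single 1 (1 : ℝ))) 1)
    (h01 : 0 ≤ (U (EuclideanSpace.single 1 (1 : ℝ))) 0) (h02 : 0 ≤ (U (EuclideanSpace.single 2 (1 : ℝ))) 0) :
    (∀ (M : ℕ) (z : Fin M → E3) (c : Fin M), Function.Injective z →
        Set.range z = {x : E3 | dist x (z c) ≤ 133 / 10 ∧ ∃ a : Fin 3 → ℤ, x = z c + latPt U fccVec a} →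
        TightNearCap (9 / 5) (3 / 2) z c ∨ ExemptNear (9 / 5) ExRec z c ∨ BadNearCap (9 / 5) (3 / 2) z c) ∨
      (μ : ℝ) / SC ≤ ∑ b ∈ (Fintype.piFinset fun _ : Fin 3 => Finset.Icc (-7 : ℤ) 7).filter (fun b => b ≠ 0),
        effPot w₄₅ ω₄ (3 / 400) ‖latPt U fccVec b‖ := by
  rw [entryLeafOK8Q, Bool.or_eq_true] at h
  rcases h with h | h
  · exact (false_of_vecOut h U hU (hbox_sym hsa hbox)).elim
  · exact entryLeafOK7Q_sound h U hsa hU hbox h1 h2 h01 h02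

/-- Monotonicity `7Q ⇒ 8Q` pointwise. [formal bookkeeping] -/
theorem entryLeafOK8Q_of_7Q (μ : ℤ) (c w : Fin 3 × Fin 3 → ℤ) (h : entryLeafOK7Q μ c w = true) : entryLeafOK8Q μ c w = true := by
  rw [entryLeafOK8Q, h, Bool.or_true]

/-- … on certificate trees. [formal bookkeeping] -/
theorem treeOK_8Q_of_7Q (μ : ℤ) (t : CertTree (Fin 3 × Fin 3)) (c w : Fin 3 × Fin 3 → ℤ) (h : treeOK (entryLeafOK7Q μ) t c w = true) :
    treeOK (entryLeafOK8Q μ) t c w = true :=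
  treeOK_of_imp (entryLeafOK8Q_of_7Q μ) t c w h

/-- … on ∃-tree facts. [formal bookkeeping] -/
theorem exists_tree_8Q_of_7Q {μ : ℤ} {c w : Fin 3 × Fin 3 → ℤ} (h : ∃ t : CertTree (Fin 3 × Fin 3), treeOK (entryLeafOK7Q μ) t c w = true) :
    ∃ t : CertTree (Fin 3 × Fin 3), treeOK (entryLeafOK8Q μ) t c w = true := by
  obtain ⟨t, ht⟩ := h
  exact ⟨t, treeOK_8Q_of_7Q μ t c w ht⟩

/-- ★★ The fcc half from ONE certificate TREE with `entryLeafOK8Q μ` on the root cube. [folklore] -/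
theorem fccHalf_of_entryTree8Q {m : ℝ} {μ : ℤ} (hμ : 2 * (m + (-(7175 / 10000) + 3 / 400)) * SC ≤ μ) {t : CertTree (Fin 3 × Fin 3)}
    (h : treeOK (entryLeafOK8Q μ) t rootC rootW = true) :
    ∀ U : E3 →L[ℝ] E3, (∀ v w : E3, inner ℝ (U v) w = inner ℝ v (U w)) → (∀ w : E3, 0 ≤ inner ℝ w (U w)) → ‖U - 1‖ ≤ 1 / 4 →
      (∀ (M : ℕ) (z : Fin M → E3) (c : Fin M), Function.Injective z →
          Set.range z = {x : E3 | dist x (z c) ≤ 133 / 10 ∧ ∃ a : Fin 3 → ℤ, x = z c + latPt U fccVec a} →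
          TightNearCap (9 / 5) (3 / 2) z c ∨ ExemptNear (9 / 5) ExRec z c ∨ BadNearCap (9 / 5) (3 / 2) z c) ∨
      m ≤ (∑ b ∈ (Fintype.piFinset fun _ : Fin 3 => Finset.Icc (-7 : ℤ) 7).filter (fun b => b ≠ 0),
        effPot w₄₅ ω₄ (3 / 400) ‖latPt U fccVec b‖) / 2 - (-(7175 / 10000) + 3 / 400) :=
  fccHalf_of_entryTreeDom hμ (entryLeafOK8Q μ) (fun _ _ hv U hsa hU hbox h1 h2 h01 h02 => entryLeafOK8Q_sound hv U hsa hU hbox h1 h2 h01 h02) h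

/-- ★★★ **`(H) HomFloor m` FROM TWO ∃-TREE FACTS** with the v10 fcc verdict; every `m`, `μ` with `2 (m + e_W) SC ≤ μ`. [folklore] -/
theorem homFloor_of_entryTrees8Q_HVK {m : ℝ} {μ : ℤ} (hμ : 2 * (m + (-(7175 / 10000) + 3 / 400)) * SC ≤ μ)
    (hF : ∃ t : CertTree (Fin 3 × Fin 3), treeOK (entryLeafOK8Q μ) t rootC rootW = true)
    (hH : ∃ t : CertTree ((Fin 3 × Fin 3) ⊕ Fin 3), treeOK (entryLeafOKHVK μ) t rootCH rootWH = true) : HomFloor m := by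
  obtain ⟨tF, htF⟩ := hF
  obtain ⟨tH, htH⟩ := hH
  exact homFloor_of_prunedBoxSums_selfAdjoint (fccHalf_of_entryTree8Q hμ htF) (hcpHalf_of_entryTreeHVK hμ htH)

/-- ★★★ **`(H) HomFloor (1/625)`, CERTIFICATE v10** (fcc `entryLeafOK8Q muRec`, hcp `entryLeafOKHVK muRec`). [folklore] -/
theorem homFloor_625_of_entryTrees8Q_HVK
    (hF : ∃ t : CertTree (Fin 3 × Fin 3), treeOK (entryLeafOK8Q muRec) t rootC rootW = true)
    (hH : ∃ t : CertTree ((Fin 3 × Fin 3) ⊕ Fin 3), treeOK (entryLeafOKHVK muRec) t rootCH rootWH = true) : HomFloor (1 / 625) :=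
  homFloor_of_entryTrees8Q_HVK muRec_ok hF hH

/-! ## §4. Kernel regression test -/

/-- The budget-stop box of the heavy guard address `000101100010` under `entryLeafOK7Q` (3000 nodes, depth 32): centre. -/
def heavyC : Fin 3 × Fin 3 → ℤ := fun ab =>
  if ab = (0, 0) then 249589139505152 else if ab = (0, 1) then 2199023255552 else if ab = (0, 2) then -2199023255552
  else if ab = (1, 1) then 225399883694080 else if ab = (1, 2) then 28587302322176 else if ab = (2, 2) then 226499395321856 else 0

/-- … and half-widths. -/
def heavyW : Fin 3 × Fin 3 → ℤ := fun ab =>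
  if ab = (0, 0) then 1099511627776 else if ab = (0, 1) then 2199023255552 else if ab = (0, 2) then 2199023255552
  else if ab = (1, 1) then 1099511627776 else if ab = (1, 2) then 2199023255552 else if ab = (2, 2) then 2199023255552 else 70368744177664

/-- The direction prune fires there (direction `(0, 1, −1)`), where `entryLeafOK7Q` needed a deep table subtree. -/
example : vecOut (heavyC ∘ symIdx) (heavyW ∘ symIdx) = true := by decide +kernel

end Summit.AtomisticToContinuum.Crystallization.Theorems.FrustratedLawDichotomyStrainedPatchHomEntryVec
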